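import Summits.Ventures.LatticeQCDFlow.Scaling.SkipFreeCountFloor

/-!
HONEST FRAMING: exact (Metropolis-corrected) sampling algorithms for lattice gauge theory; figures
of merit are autocorrelation/cost numbers at stated couplings and volumes; no continuum-physics
claim.

# TwoStageCountFloor — LABELS THAT DIE ONLY AT A HUB THEY RARELY OCCUPY: IF A COUNT `V` LOSES A UNIT ONLY BY SENDING IT TO A ONE-SLOT HUB
# (RATE `≤ αV`), WHERE IT DIES AT RATE `≤ h` UNLESS PUSHED BACK (RATE `≥ β_V`), THEN `P_x{extinct at n} ≤ (1+λ)ⁿ·G(V(x), b(x))` FOR EVERY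
# SUPER-SOLUTION `G` OF THE TWO-STAGE RECURSION — THE GENERIC HALF OF THE REFRESH BUDGET'S `log K` (lean-2 GEN-29, ours)

Venture-side (OURS).  Cell `lqcd-flow` (pub-lqcd), unit `pub-lqcd-lean-2-g29`, 2026-08-28.  Chapter O, file 11: the two-component version of
`Scaling/SkipFreeCountFloor` (O6).  O6 bounds extinction when every unit of the count dies at rate `≤ λ` wherever it is; for the hub's REFRESH budget
a planted label dies only at the hub (hot redraw, rate `≤ h`), reaches the hub only through an accepted swap (rate `≤ α` per labelled replica), and is
pushed back into an unlabelled replica at rate `≥ β_V` — so it occupies the hub a fraction `≈ α/(β)` of the time and the death rate per label is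
`≈ hα/β`, not `h`.  This file proves the comparison principle: any non-negative `G(V,b)` on `ℕ × Bool` with `G(0,⊥) ≥ 1`, the monotonicity
`G(V+1,⊥) ≤ G(V,⊤) ≤ G(V,⊥)` and the two first-step inequalities
`λ·G(V,⊥) ≥ αV·(G(V−1,⊤) − G(V,⊥))`, `λ·G(V,⊤) ≥ h·(G(V,⊥) − G(V,⊤)) − β_V·(G(V,⊤) − G(V+1,⊥))`
dominates: `P_x{V(X_n) = 0, hub empty} ≤ (1+λ)ⁿ·G(V(x), b(x))`.  The explicit `G` and the application to the hub are left to the sequel.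

## What is proved

* **`twoStage_extinction_le`** — the comparison principle above, for a row-stochastic `P`, `V : X → ℕ`, `b : X → Bool` with the transition structure:
  from `b(x) = ⊥`, every successor has `V(y) + 1 ≥ V(x)` and `V(y) + 1 = V(x) → b(y) = ⊤`, and `Σ_{V(y) < V(x)} P(x,y) ≤ α·V(x)`; from `b(x) = ⊤`,
  every successor has `V(y) ≥ V(x)`, `Σ_{¬b(y), V(y) = V(x)} P(x,y) ≤ h` and `Σ_{V(y) ≥ V(x)+1} P(x,y) ≥ β(V(x))`.
* **`twoStage_worstTvDist_ge`** — `d(n) ≥ 1 − (1+λ)ⁿ·G(V(x),b(x)) − π{V ≥ 1 ∨ b}`.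

Reading (no numerics implied): the refresh budget's coupon collector with the quality needs exactly this principle plus an explicit super-solution;
the paper computation (`G(V,⊤) = ρ_V G(V,⊥)`, `ρ_V = h/(h + λ + β_Vλ/(αV+λ))`, `G(V,⊥) = Π_{j≤V} ρ_{j−1}/(1 + λ/(αj))`, `λ = sα`, giving
`t_mix ≳ (β/(hα))·log K = (p/p')·K/(2(1−t)w_0·p'q')·log K` at uniform listing) is recorded in OPEN-MATH-chapterM.md (GEN-29 addendum) and NOT
typed here.  NOT CLAIMED: the explicit super-solution; the application; anything measured.  Literature grade (cell rule): OWN LEMMA; nothing cited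
as a fact; no new bib keys.
-/

noncomputable section

open Finset Function
open Literature.Probability.MarkovChains

namespace Summit.Ventures.LatticeQCDFlow.Scaling

variable {X : Type*} [Fintype X] [DecidableEq X]

/-- **THE TWO-STAGE COMPARISON PRINCIPLE.** [ours] -/
theorem twoStage_extinction_le {P : X → X → ℝ} (hP : IsRowStochastic P) (V : X → ℕ) (b : X → Bool)
    -- structure from an empty hub
    (hS0 : ∀ x y, b x = false → P x y ≠ 0 → V x ≤ V y + 1 ∧ (V y + 1 = V x → b y = true))
    -- structure from a labelled hub
    (hS1 : ∀ x y, b x = true → P x y ≠ 0 → V x ≤ V y)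
    {α h : ℝ} {β : ℕ → ℝ}
    (hR0 : ∀ x, b x = false → ∑ y ∈ univ.filter (fun y => V y < V x), P x y ≤ α * V x)
    (hR1 : ∀ x, b x = true → ∑ y ∈ univ.filter (fun y => b y = false ∧ V y = V x), P x y ≤ h)
    (hR2 : ∀ x, b x = true → β (V x) ≤ ∑ y ∈ univ.filter (fun y => V x + 1 ≤ V y), P x y)
    {lam : ℝ} (hlam : 0 ≤ lam) (G : ℕ → Bool → ℝ) (hG0 : ∀ v c, 0 ≤ G v c) (hG00 : 1 ≤ G 0 false)
    (hmono1 : ∀ v, G v true ≤ G v false) (hmono2 : ∀ v, G (v + 1) false ≤ G v true)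
    (hI0 : ∀ v : ℕ, 1 ≤ v → α * v * (G (v - 1) true - G v false) ≤ lam * G v false)
    (hI1 : ∀ v : ℕ, h * (G v false - G v true) - β v * (G v true - G (v + 1) false) ≤ lam * G v true) :
    ∀ (n : ℕ) (x : X), ∑ y ∈ univ.filter (fun y => V y = 0 ∧ b y = false), lawAt P (Pi.single x 1) n y
      ≤ (1 + lam) ^ n * G (V x) (b x) := by
  -- antitonicity of `G` along the chain of classes
  have hanti_false : ∀ v v', v ≤ v' → G v' false ≤ G v false := by
    intro v v' hvv'
    induction v' with
    | zero => rw [Nat.le_zero.mp hvv']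
    | succ v' ih =>
      rcases Nat.lt_or_eq_of_le hvv' with hlt | heq
      · exact ((hmono2 v').trans (hmono1 v')).trans (ih (Nat.lt_succ_iff.mp hlt))
      · rw [heq]
  have hanti_true : ∀ v v', v ≤ v' → G v' true ≤ G v true := by
    intro v v' hvv'
    induction v' with
    | zero => rw [Nat.le_zero.mp hvv']
    | succ v' ih =>
      rcases Nat.lt_or_eq_of_le hvv' with hlt | heq
      · exact ((hmono1 (v' + 1)).trans (hmono2 v')).trans (ih (Nat.lt_succ_iff.mp hlt))
      · rw [heq]
  -- `G(v', c) ≤ G(v, true)` whenever `v' ≥ v + 1` (any `c`), and `≤ G(v,false)` whenever `v' ≥ v`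
  have hbelow_true : ∀ v v' c, v + 1 ≤ v' → G v' c ≤ G v true := by
    intro v v' c hv
    cases c
    · exact (hanti_false _ _ hv).trans (hmono2 v)
    · exact ((hmono1 v').trans (hanti_false _ _ hv)).trans (hmono2 v)
  have hbelow_false : ∀ v v' c, v ≤ v' → G v' c ≤ G v false := by
    intro v v' c hv
    cases c
    · exact hanti_false _ _ hv
    · exact (hmono1 v').trans (hanti_false _ _ hv)
  intro n
  induction n with
  | zero =>
    intro x
    rw [pow_zero, one_mul, lawAt_zero]
    by_cases hx : V x = 0 ∧ b x = false
    · rw [Finset.sum_eq_single_of_mem x (mem_filter.mpr ⟨mem_univ _, hx⟩) (fun z _ hz => Pi.single_eq_of_ne hz _),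
        Pi.single_eq_same, hx.1, hx.2]
      exact hG00
    · have h0 : ∑ y ∈ univ.filter (fun y => V y = 0 ∧ b y = false), (Pi.single x (1 : ℝ) : X → ℝ) y = 0 := by
        refine Finset.sum_eq_zero fun z hz => ?_
        have hz' := (mem_filter.mp hz).2
        have hzx : z ≠ x := fun h => hx (by rw [← h]; exact hz')
        exact Pi.single_eq_of_ne hzx _
      rw [h0]
      exact hG0 _ _
  | succ n ih =>
    intro x
    have hstep : ∑ y ∈ univ.filter (fun y => V y = 0 ∧ b y = false), lawAt P (Pi.single x 1) (n + 1) y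
        = ∑ z, P x z * ∑ y ∈ univ.filter (fun y => V y = 0 ∧ b y = false), lawAt P (Pi.single z 1) n y := by
      simp_rw [lawAt_single_succ_apply, Finset.mul_sum]
      rw [Finset.sum_comm]
    rw [hstep]
    have hih : ∀ z, P x z * ∑ y ∈ univ.filter (fun y => V y = 0 ∧ b y = false), lawAt P (Pi.single z 1) n y
        ≤ P x z * ((1 + lam) ^ n * G (V z) (b z)) := fun z => mul_le_mul_of_nonneg_left (ih z) (hP.1 x z)
    refine (sum_le_sum fun z _ => hih z).trans ?_
    have hfac : ∑ z, P x z * ((1 + lam) ^ n * G (V z) (b z)) = (1 + lam) ^ n * ∑ z, P x z * G (V z) (b z) := by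
      rw [Finset.mul_sum]; exact sum_congr rfl fun z _ => by ring
    rw [hfac, pow_succ, mul_assoc]
    refine mul_le_mul_of_nonneg_left ?_ (by positivity)
    -- the one-step inequality `Σ_z P(x,z) G(V z, b z) ≤ (1+λ) G(V x, b x)`
    cases hbx : b x with
    | false =>
      -- successors: either `V z ≥ V x` (value `≤ G(V x, false)`) or `V z = V x − 1` with `b z = true` (value `G(V x − 1, true)`)
      have hpt : ∀ z, P x z * G (V z) (b z)
          ≤ P x z * G (V x) false + (if V z < V x then P x z * (G (V x - 1) true - G (V x) false) else 0) := by
        intro z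
        by_cases hPz : P x z = 0
        · rw [hPz]; simp
        obtain ⟨h1, h2⟩ := hS0 x z hbx hPz
        by_cases hlt : V z < V x
        · have hVz : V z + 1 = V x := by omega
          have hbz := h2 hVz
          rw [if_pos hlt, hbz, show V x - 1 = V z by omega]
          ring_nf
          exact le_rfl
        · rw [if_neg hlt, add_zero]
          exact mul_le_mul_of_nonneg_left (hbelow_false _ _ _ (not_lt.mp hlt)) (hP.1 x z)
      refine (sum_le_sum fun z _ => hpt z).trans ?_
      rw [sum_add_distrib, ← sum_mul, hP.2 x, one_mul, ← Finset.sum_filter, ← sum_mul]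
      by_cases hV0 : V x = 0
      · have hemp : univ.filter (fun z => V z < V x) = ∅ := by
          rw [Finset.filter_eq_empty_iff]; intro z _; rw [hV0]; exact Nat.not_lt_zero _
        rw [hemp, sum_empty, zero_mul, add_zero]
        have := hG0 (V x) false
        nlinarith
      · have hv1 : 1 ≤ V x := Nat.one_le_iff_ne_zero.mpr hV0
        have hI := hI0 (V x) hv1
        have hdrop := hR0 x hbx
        -- the coefficient `G(V−1,true) − G(V,false)` is `≥ 0`
        have hcoef : 0 ≤ G (V x - 1) true - G (V x) false := by
          have := hmono2 (V x - 1)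
          rw [Nat.sub_add_cancel hv1] at this
          linarith
        calc G (V x) false + (∑ z ∈ univ.filter (fun z => V z < V x), P x z) * (G (V x - 1) true - G (V x) false)
            ≤ G (V x) false + α * V x * (G (V x - 1) true - G (V x) false) := by
              nlinarith [mul_le_mul_of_nonneg_right hdrop hcoef]
          _ ≤ G (V x) false + lam * G (V x) false := by linarith
          _ = (1 + lam) * G (V x) false := by ring
    | true =>
      -- successors: `V z ≥ V x`; value `≤ G(V x,true)` unless (death: `¬b z ∧ V z = V x`, value `G(V x,false)`) or (push: `V z ≥ V x+1`, value `≤ G(V x+1,false)`)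
      have hpt : ∀ z, P x z * G (V z) (b z)
          ≤ P x z * G (V x) true
            + (if (b z = false ∧ V z = V x) then P x z * (G (V x) false - G (V x) true) else 0)
            - (if V x + 1 ≤ V z then P x z * (G (V x) true - G (V x + 1) false) else 0) := by
        intro z
        by_cases hPz : P x z = 0
        · rw [hPz]; simp
        have hge := hS1 x z hbx hPz
        by_cases hpush : V x + 1 ≤ V z
        · have hnd : ¬(b z = false ∧ V z = V x) := fun h => by omega
          rw [if_neg hnd, if_pos hpush, add_zero]
          have := mul_le_mul_of_nonneg_left (hbelow_false (V x + 1) (V z) (b z) hpush) (hP.1 x z)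
          linarith
        · have hVz : V z = V x := by omega
          rw [if_neg hpush, sub_zero]
          cases hbz : b z with
          | false =>
            rw [if_pos ⟨rfl, hVz⟩, hVz]
            ring_nf
            exact le_rfl
          | true =>
            have hnd : ¬(true = false ∧ V z = V x) := fun h => Bool.noConfusion h.1
            rw [if_neg hnd, add_zero, hVz]
      refine (sum_le_sum fun z _ => hpt z).trans ?_
      rw [sum_sub_distrib, sum_add_distrib, ← sum_mul, hP.2 x, one_mul, ← Finset.sum_filter, ← Finset.sum_filter, ← sum_mul, ← sum_mul]
      have hdeath := hR1 x hbx
      have hpushm := hR2 x hbx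
      have hc1 : 0 ≤ G (V x) false - G (V x) true := by linarith [hmono1 (V x)]
      have hc2 : 0 ≤ G (V x) true - G (V x + 1) false := by linarith [hmono2 (V x)]
      have hI := hI1 (V x)
      calc G (V x) true + (∑ z ∈ univ.filter (fun z => b z = false ∧ V z = V x), P x z) * (G (V x) false - G (V x) true)
            - (∑ z ∈ univ.filter (fun z => V x + 1 ≤ V z), P x z) * (G (V x) true - G (V x + 1) false)
          ≤ G (V x) true + h * (G (V x) false - G (V x) true) - β (V x) * (G (V x) true - G (V x + 1) false) := by
            nlinarith [mul_le_mul_of_nonneg_right hdeath hc1, mul_le_mul_of_nonneg_right hpushm hc2]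
        _ ≤ G (V x) true + lam * G (V x) true := by linarith
        _ = (1 + lam) * G (V x) true := by ring

/-- **`d(n) ≥ 1 − (1+λ)ⁿ·G(V(x),b(x)) − δ`** whenever `π{¬(V = 0 ∧ hub empty)} ≤ δ` (hypotheses of the principle). [ours] -/
theorem twoStage_worstTvDist_ge {P : X → X → ℝ} (hP : IsRowStochastic P) (V : X → ℕ) (b : X → Bool)
    (hS0 : ∀ x y, b x = false → P x y ≠ 0 → V x ≤ V y + 1 ∧ (V y + 1 = V x → b y = true))
    (hS1 : ∀ x y, b x = true → P x y ≠ 0 → V x ≤ V y)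
    {α h : ℝ} {β : ℕ → ℝ}
    (hR0 : ∀ x, b x = false → ∑ y ∈ univ.filter (fun y => V y < V x), P x y ≤ α * V x)
    (hR1 : ∀ x, b x = true → ∑ y ∈ univ.filter (fun y => b y = false ∧ V y = V x), P x y ≤ h)
    (hR2 : ∀ x, b x = true → β (V x) ≤ ∑ y ∈ univ.filter (fun y => V x + 1 ≤ V y), P x y)
    {lam : ℝ} (hlam : 0 ≤ lam) (G : ℕ → Bool → ℝ) (hG0 : ∀ v c, 0 ≤ G v c) (hG00 : 1 ≤ G 0 false)
    (hmono1 : ∀ v, G v true ≤ G v false) (hmono2 : ∀ v, G (v + 1) false ≤ G v true)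
    (hI0 : ∀ v : ℕ, 1 ≤ v → α * v * (G (v - 1) true - G v false) ≤ lam * G v false)
    (hI1 : ∀ v : ℕ, h * (G v false - G v true) - β v * (G v true - G (v + 1) false) ≤ lam * G v true)
    {π : X → ℝ} (hπ1 : ∑ y, π y = 1) {δ : ℝ} (hδ : ∑ y ∈ univ.filter (fun y => ¬(V y = 0 ∧ b y = false)), π y ≤ δ) (x : X) (n : ℕ) :
    1 - (1 + lam) ^ n * G (V x) (b x) - δ ≤ worstTvDist P π n := by
  refine le_trans ?_ (tvDist_single_le_worstTvDist P π n x)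
  have hmass : ∑ y, lawAt P (Pi.single x 1) n y = ∑ y, π y := by
    rw [sum_lawAt hP, hπ1]; simp
  have hev := sub_sum_le_tvDist hmass (univ.filter (fun y => ¬(V y = 0 ∧ b y = false)))
  have hcompl : ∑ y ∈ univ.filter (fun y => ¬(V y = 0 ∧ b y = false)), lawAt P (Pi.single x 1) n y
      = 1 - ∑ y ∈ univ.filter (fun y => V y = 0 ∧ b y = false), lawAt P (Pi.single x 1) n y := by
    have h := Finset.sum_filter_add_sum_filter_not univ (fun y => V y = 0 ∧ b y = false) (lawAt P (Pi.single x 1) n)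
    rw [sum_lawAt hP] at h
    simp only [Pi.single_apply, Finset.sum_ite_eq', mem_univ, if_true] at h
    linarith
  have hext := twoStage_extinction_le hP V b hS0 hS1 hR0 hR1 hR2 hlam G hG0 hG00 hmono1 hmono2 hI0 hI1 n x
  linarith

end Summit.Ventures.LatticeQCDFlow.Scaling

end
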